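import Summits.Schanuel.Schanuel.Theorems.RootDecomp1KTrinomialDescent02

/-!
# RootDecomp1KTrinomialDescent — lens 1, generation 64, NODE 25 «TRINOMIAL (FERMAT-QUOTIENT) DESCENT ON THE K-LINE — the curve X3 decided: EMPTY AT EVERY LEVEL» (×0-as-record under RULE K-R51 (i): for every trinomial σ₀Y^d + σ₁2^s·x^i·Y^k + σ₂x^j with Δ = (d−k)(j−i) − i·k odd ≥ 3 and primitive inner edges — the class FermatTri — NO rational point over any dyadic x = p/2^n, p odd, |p| ≠ 1, n ≥ 1, hence no level point for N ≥ 2 ⇒ LevelFinite / ThinFibreAt ∀ m₀ / BddLevelEmpty; X3 = x³ + Y·x + Y⁷ EMPTY at every level N ≥ 0; elementary: unique factorisation + parity; CLAIM L2956, PRICE L2959 (β), ERRATUM E3, RULE K-R56) — continuation (RootDecomp1KTrinomialDescent03): §B the trinomial term triP and the class FermatTri (section Trinomial); §C (M1) the 2-adic descent at a dyadic abscissa (section TwoAdic); §D the K-line: no level point for N ≥ 2, the doors (section KLine)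

(lens-1 g64 NODE 25 «TRINOMIAL (FERMAT-QUOTIENT) DESCENT ON THE K-LINE — the curve X3 decided: EMPTY AT EVERY LEVEL» L2968: HOME kernel K = HOME/decomp-schanuel-lens-1/g64/lean/TrinomialDescent.lean sha256 e7961d57…, 1095 l, 95 decls, ONE namespace `Summit.Schanuel.Schanuel.Theorems.RootDecomp1KTrinomialDescent`, imports the tree port …RootDecomp1KSuperellipticSiegel06 ONLY; no private, no instance, no set_option, no notation, no sorry, no decide; lens farm: K rc 0 · 0 errors · 0 sorries, Probe rc 0 (155 `#print axioms` guards ⊆ the standard triple), Ctrl0 rc 0, Ctrl rc 1 = 35 planted errors exactly; CLAIM L2956 (ASK-FIRST under K-R55 (iii)); crit g12 PRICE L2959: RULING (β) ×0-AS-RECORD under RULE K-R51 (i) (descent lane: Chevalley–Weil along the étale μ₁₁-torsor defined by the ℚ-rational cuspidal 11-torsion of J_X3 + an elementary step upstairs) — «BUILD, ×0 VERDICT and RECORD PORT WELCOME AND REQUESTED»; ERRATUM E3 (critic's: X3 is NOT open territory — STRUCK as standing witness); RULE K-R56 PRE-ANNOUNCED; CHECKLIST K-g64 (1)–(9); census LIVENESS-v31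 (keys tri / cusp / jac of record L2969: FermatTri YES on X3 only, cuspidal group of order 11, census kit jac: #J_X3(𝔽_p) for p = 5, 13, 23 has gcd exactly 11); writer g34 NOTE 4 L2960 (pre-check 15/15 + 5/5); critic VERDICT: VERIFIED, OF RECORD: ×0-AS-RECORD under RULE K-R51 (i) (the descent lane; no credit class), VERDICT L2971 (crit-1 g12, 2026-09-02T00:18Z): CHECKLIST K-g64 (1)–(9) met item by item on the critic's own farm runs (K rc 0 · 0 errors · 0 sorries; Probe rc 0 with 155 `#print axioms` closures ⊆ the standard triple; Ctrl0 rc 0; Ctrl rc 1 = exactly the 35 planted errors; Pin25.lean 25/25); tally of record UNCHANGED lens-1 ×21 + THEOREM ×23; ERRATUM E3 FINAL (X3 = x³ + Y·x + Y⁷ STRUCK as standing witness: J_X3(ℚ)[11] ∋ [P₁ − P_∞] cuspidal; census jac gcd = 11 at p = 5, 13, 23); RULE K-R56 FIXED (+ the (d2) precision and GLOSS); PORT GO L2973 (×0 RECORD port, census-1; `--supports stmt-Schanuel-33364`, the item stays OPEN). Port by census-1 gen 24 as `RootDecomp1KTrinomialDescent01–05` (`--supports stmt-Schanuel-33364`;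 the item stays OPEN; ×0 record port, no credit anywhere): 01 = §A arithmetic part 1 (section Arithmetic: L1 parity lemmas `odd_geom_sum₂` / `le_geom_sum₂` / `pow_ne_pow_add_two_pow` / `eq_one_of_pow_add_pow_eq_two_pow` / `pow_ne_pow_add_two_pow_both`, valuations, perfect powers; section Arithmetic closed at the cut); 02 = §A part 2 (section Arithmetic re-opened: section Core — `perPrime`, `trinomial_core`); 03 = §B the term `triP` and the class `def FermatTri` (section Trinomial) + §C (M1) the 2-adic descent `den_of_root_triP` / `bev_triP_ne_zero_of_dyadic` (section TwoAdic) + §D the K-line doors `no_level_of_fermatTri` / `levelFinite_of_fermatTri` / `thinFibreAt_of_fermatTri` / `bddLevelEmpty_of_fermatTri` (section KLine); 04 = §F the term of record `X3P` (`bev_X3P`, `fermatTri_X3P`, `no_level_X3P`, `levelSet_X3P_eq_empty`, `levelFinite_X3P`, `thinFibreAt_X3P`, `bddLevelEmpty_X3P`) and the family `FT` (section Witness); 05 = §T territory refusals by tree names (`xdeg_X3P`, `not_domSuper_X3P`, `not_domHyper_X3P`, `den_of_level_X3P`, the class boundary `not_fermatTri_of_two_coeffs`, the nominee `X5P` typed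 as a NON-member) (section Territory) + §N sharpness (section Sharpness). Text = K VERBATIM (every declaration documented by the lens; statements and proofs unchanged; K's module docstring kept in part 01 below this provenance block).)
-/

noncomputable section

namespace Summit.Schanuel.Schanuel.Theorems.RootDecomp1KTrinomialDescent

open Polynomial Finset
open LiouvilleNumber
open scoped Nat
open Summit.Schanuel.Schanuel.Theorems.RootDecomp1KDegreeLadder
open Summit.Schanuel.Schanuel.Theorems.RootDecomp1KXTop
open Summit.Schanuel.Schanuel.Theorems.RootDecomp1KXAll
open Summit.Schanuel.Schanuel.Theorems.RootDecomp1KLevelFinite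
open Summit.Schanuel.Schanuel.Theorems.RootDecomp1KHeightGrading (BddLevelEmpty bddLevelEmpty_iff_levelFinite H17P h17C
  h17C_one)
open Summit.Schanuel.Schanuel.Theorems.RootDecomp1KOddEmpty (levelFinite_of_no_level W4P w4C)
open Summit.Schanuel.Schanuel.Theorems.RootDecomp1KTwoBaseCell (psNumer partialSum_eq_psNumer_div coprime_psNumer)
open Summit.Schanuel.Schanuel.Theorems.RootDecomp1KRelLiouvilleCell (partialSum_two_zero)
open Summit.Schanuel.Schanuel.Theorems.RootDecomp1KRunge (psNumer_pos_runge RW rwC rwC_four)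
open Summit.Schanuel.Schanuel.Theorems.RootDecomp1KSuperellipticSiegel (DomSuper exists_root_septic T tC A xCoeff_T
  tC_zero coeff_A_seven coeff_A_zero twoTermC twoTermP_eq_xPolyP)
open Summit.Schanuel.Schanuel.Theorems.RootDecomp1KHyperellipticSiegel (DomHyper)

/-! ## §B  THE TRINOMIAL TERM AND THE CLASS `FermatTri` -/

section Trinomial

/-- [term] **the trinomial `σ₀·Y^(m+k) + σ₁·2^s·x^i·Y^k + σ₂·x^(l+i)`** as an element of `ℤ[X][X]` (tree convention:
inner `X` = the abscissa `x`, outer `X` = the ordinate `Y`); `d = m + k` is the `Y`-degree, `j = l + i` the `x`-degree. -/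
def triP (σ₀ a σ₂ : ℤ) (m i k l : ℕ) : ℤ[X][X] :=
  C (C σ₀) * X ^ (m + k) + C (C a * X ^ i) * X ^ k + C (C σ₂ * X ^ (l + i))

/-- evaluation: `bev (triP σ₀ a σ₂ m i k l) x y = σ₀·y^(m+k) + a·x^i·y^k + σ₂·x^(l+i)` (the middle coefficient `a`
is `σ₁·2^s` throughout). -/
@[simp] theorem bev_triP (σ₀ a σ₂ : ℤ) (m i k l : ℕ) (x y : ℝ) :
    bev (triP σ₀ a σ₂ m i k l) x y = σ₀ * y ^ (m + k) + a * x ^ i * y ^ k + σ₂ * x ^ (l + i) := by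
  simp [triP]

/-- [class] definition (census convention): **THE FERMAT-TRINOMIAL CLASS `FermatTri P`** — `P` is a trinomial
`σ₀·Y^(m+k) + σ₁·2^s·x^i·Y^k + σ₂·x^(l+i)` with signs `σ_ν = ±1`, a genuine middle term (`i, k ≥ 1`), edge determinant
`Δ = l·m − i·k` ODD and `≥ 3`, and PRIMITIVE edges `m ⊥ i`, `k ⊥ l`.  NO dominance, NO lacunarity, NO separability,
NO slope / root / local datum. -/
def FermatTri (P : ℤ[X][X]) : Prop :=
  ∃ (σ₀ σ₁ σ₂ : ℤ) (s m i k l Δ : ℕ), (σ₀ = 1 ∨ σ₀ = -1) ∧ (σ₁ = 1 ∨ σ₁ = -1) ∧ (σ₂ = 1 ∨ σ₂ = -1) ∧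
    0 < i ∧ 0 < k ∧ l * m = Δ + i * k ∧ Odd Δ ∧ 3 ≤ Δ ∧ Nat.Coprime m i ∧ Nat.Coprime k l ∧
    P = triP σ₀ (σ₁ * 2 ^ s) σ₂ m i k l

/-- `{σ₀ σ₁ σ₂ : ℤ} (h₀ : σ₀ = 1 ∨ σ₀ = -1) (h₁ : σ₁ = 1 ∨ σ₁ = -1) (h₂ : σ₂ = 1 ∨ σ₂ = -1) {s m i k l Δ : ℕ} (hi : 0 < i) (hk : 0 < k) (hΔ : l * m = Δ + i * k) (hΔo : Odd Δ) (hΔ3 : 3 ≤ Δ) (hmi : Nat.Coprime m i) (hkl : Na…`. -/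
theorem fermatTri_triP {σ₀ σ₁ σ₂ : ℤ} (h₀ : σ₀ = 1 ∨ σ₀ = -1) (h₁ : σ₁ = 1 ∨ σ₁ = -1) (h₂ : σ₂ = 1 ∨ σ₂ = -1)
    {s m i k l Δ : ℕ} (hi : 0 < i) (hk : 0 < k) (hΔ : l * m = Δ + i * k) (hΔo : Odd Δ) (hΔ3 : 3 ≤ Δ)
    (hmi : Nat.Coprime m i) (hkl : Nat.Coprime k l) : FermatTri (triP σ₀ (σ₁ * 2 ^ s) σ₂ m i k l) :=
  ⟨σ₀, σ₁, σ₂, s, m, i, k, l, Δ, h₀, h₁, h₂, hi, hk, hΔ, hΔo, hΔ3, hmi, hkl, rfl⟩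

end Trinomial

/-! ## §C  (M1) THE 2-ADIC DESCENT AT A DYADIC ABSCISSA `x = p / 2^n` -/

section TwoAdic

/-- `{σ : ℤ} (h : σ = 1 ∨ σ = -1) : Odd σ`. -/
theorem odd_of_sign {σ : ℤ} (h : σ = 1 ∨ σ = -1) : Odd σ := by
  rcases h with rfl | rfl
  exacts [odd_one, odd_neg_one]

/-- `{σ : ℤ} (h : σ = 1 ∨ σ = -1) : σ.natAbs = 1`. -/
theorem natAbs_of_sign {σ : ℤ} (h : σ = 1 ∨ σ = -1) : σ.natAbs = 1 := by
  rcases h with rfl | rfl <;> rfl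

/-- a unique LEAST 2-adic weight is impossible: `odd·2^A + x·2^B + y·2^C ≠ 0` when `A < B`, `A < C`. -/
theorem two_adic_strict {o x y : ℤ} (ho : Odd o) {A B C : ℕ} (hAB : A < B) (hAC : A < C) :
    o * 2 ^ A + x * 2 ^ B + y * 2 ^ C ≠ 0 := by
  intro h
  obtain ⟨B', rfl⟩ : ∃ B', B = A + (B' + 1) := ⟨B - A - 1, by omega⟩
  obtain ⟨C', rfl⟩ : ∃ C', C = A + (C' + 1) := ⟨C - A - 1, by omega⟩
  have h' : (2 : ℤ) ^ A * (o + 2 * (x * 2 ^ B' + y * 2 ^ C')) = 0 := by rw [← h]; ring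
  have h'' := (mul_eq_zero.mp h').resolve_left (pow_ne_zero _ two_ne_zero)
  have hodd : Odd (o + 2 * (x * 2 ^ B' + y * 2 ^ C')) := ho.add_even (even_two_mul _)
  rw [h''] at hodd
  have := Int.odd_iff.mp hodd
  omega

/-- **the two least 2-adic weights tie**: if `o₁·2^A + o₂·2^B + o₃·2^C = 0` with `o_ν` odd, the minimum of
`A, B, C` is attained twice. -/
theorem two_adic_tie {o₁ o₂ o₃ : ℤ} (h₁ : Odd o₁) (h₂ : Odd o₂) (h₃ : Odd o₃) {A B C : ℕ}
    (h : o₁ * 2 ^ A + o₂ * 2 ^ B + o₃ * 2 ^ C = 0) :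
    (A = B ∧ A ≤ C) ∨ (A = C ∧ A ≤ B) ∨ (B = C ∧ B ≤ A) := by
  have n1 : ¬ (A < B ∧ A < C) := fun hh => two_adic_strict h₁ hh.1 hh.2 h
  have n2 : ¬ (B < A ∧ B < C) := fun hh =>
    two_adic_strict h₂ hh.1 hh.2 (x := o₁) (y := o₃) (by linear_combination h)
  have n3 : ¬ (C < A ∧ C < B) := fun hh =>
    two_adic_strict h₃ hh.1 hh.2 (x := o₁) (y := o₂) (by linear_combination h)
  omega

/-- the ties through the MIDDLE weight are absurd: `e·k ≥ n·l` and `n·i ≥ e·m` with `e, n ≥ 1` force `ik ≥ lm`. -/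
theorem weights_absurd {m i k l Δ e n : ℕ} (hΔ : l * m = Δ + i * k) (hΔ3 : 3 ≤ Δ) (he : 1 ≤ e) (hn : 1 ≤ n)
    (h1 : n * l ≤ e * k) (h2 : e * m ≤ n * i) : False := by
  have h := Nat.mul_le_mul h1 h2
  have key : n * l * (e * m) = e * n * Δ + e * k * (n * i) := by
    rw [show n * l * (e * m) = e * n * (l * m) by ring, hΔ]; ring
  rw [key] at h
  have hpos : 0 < e * n * Δ := Nat.mul_pos (Nat.mul_pos (by omega) (by omega)) (by omega)
  set c := e * k * (n * i)
  set d := e * n * Δ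
  omega

/-- (E0) CLEARING DENOMINATORS: with `u = num r`, `v = den r`,
`v^(m+k)·2^(n(l+i))·P(p/2^n, r) = σ₀u^(m+k)2^(nl+ni) + σ₁2^s p^i u^k v^m 2^(nl) + σ₂p^(l+i)v^(m+k)`. -/
theorem clear_triP (σ₀ σ₁ σ₂ : ℤ) (s m i k l : ℕ) (p : ℤ) (n : ℕ) (r : ℚ) :
    ((σ₀ * r.num ^ (m + k) * 2 ^ (n * l + n * i) + σ₁ * 2 ^ s * p ^ i * r.num ^ k * (r.den : ℤ) ^ m * 2 ^ (n * l) +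
        σ₂ * p ^ (l + i) * (r.den : ℤ) ^ (m + k) : ℤ) : ℝ) =
      (r.den : ℝ) ^ (m + k) * (2 : ℝ) ^ (n * l + n * i) *
        bev (triP σ₀ (σ₁ * 2 ^ s) σ₂ m i k l) ((p : ℝ) / 2 ^ n) r := by
  have hnum : ((r.num : ℚ) : ℝ) = (r : ℝ) * (r.den : ℝ) := by
    have e : ((r * r.den : ℚ) : ℝ) = ((r.num : ℚ) : ℝ) := by rw [Rat.mul_den_eq_num]
    push_cast at e ⊢
    exact e.symm
  have hp : (p : ℝ) = (p : ℝ) / 2 ^ n * 2 ^ n := (div_mul_cancel₀ _ (pow_ne_zero _ two_ne_zero)).symm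
  rw [bev_triP]
  push_cast at hnum ⊢
  rw [hnum]
  set x : ℝ := (p : ℝ) / 2 ^ n with hx
  rw [hp]
  ring

/-- **(M1) THE DESCENT LEMMA.**  At a dyadic abscissa `x = p/2^n` (`p` odd, `n ≥ 1`), a rational root `r` of a
trinomial with a genuine middle term (`i, k ≥ 1`) and `l·m > i·k` has `den r = 2^e` with `e ≥ 1`, the OUTER 2-adic
weights tie — `n(l+i) = e(m+k) ≤ s + nl + em` —, `num r` is odd, and the equation DESCENDS to the odd core
`σ₀·u^(m+k) + σ₁·2^M·p^i·u^k + σ₂·p^(l+i) = 0`, `M = s + nl + em − n(l+i)`, `u = num r`. -/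
theorem descent_triP {σ₀ σ₁ σ₂ : ℤ} (h₀ : σ₀ = 1 ∨ σ₀ = -1) (h₁ : σ₁ = 1 ∨ σ₁ = -1) (h₂ : σ₂ = 1 ∨ σ₂ = -1)
    {s m i k l Δ : ℕ} (hi : 0 < i) (hk : 0 < k) (hΔ : l * m = Δ + i * k) (hΔ3 : 3 ≤ Δ)
    {p : ℤ} (hp : Odd p) {n : ℕ} (hn : 1 ≤ n) {r : ℚ}
    (h : bev (triP σ₀ (σ₁ * 2 ^ s) σ₂ m i k l) ((p : ℝ) / 2 ^ n) r = 0) :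
    ∃ e : ℕ, r.den = 2 ^ e ∧ 1 ≤ e ∧ n * l + n * i = e * m + e * k ∧ n * l + n * i ≤ s + n * l + e * m ∧ Odd r.num ∧
      σ₀ * r.num ^ (m + k) + σ₁ * 2 ^ (s + n * l + e * m - (n * l + n * i)) * p ^ i * r.num ^ k +
        σ₂ * p ^ (l + i) = 0 := by
  have hm : 0 < m := Nat.pos_of_ne_zero fun h0 => by subst h0; simp at hΔ; omega
  have hl : 0 < l := Nat.pos_of_ne_zero fun h0 => by subst h0; simp at hΔ; omega
  set u := r.num with hu
  set v := r.den with hv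
  have cop : Nat.Coprime u.natAbs v := r.reduced
  -- (E0)
  have E0 : σ₀ * u ^ (m + k) * 2 ^ (n * l + n * i) + σ₁ * 2 ^ s * p ^ i * u ^ k * (v : ℤ) ^ m * 2 ^ (n * l) +
      σ₂ * p ^ (l + i) * (v : ℤ) ^ (m + k) = 0 := by
    have e := clear_triP σ₀ σ₁ σ₂ s m i k l p n r
    rw [h, mul_zero] at e
    exact_mod_cast e
  have hσ₀ := odd_of_sign h₀
  have hσ₁ := odd_of_sign h₁
  have hσ₂ := odd_of_sign h₂
  -- (1) no odd prime divides v
  have hv2 : ∀ {q : ℕ}, q.Prime → q ∣ v → q = 2 := by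
    intro q hq hqv
    by_contra hq2
    have hqZ : Prime (q : ℤ) := Nat.prime_iff_prime_int.mp hq
    have hqv' : (q : ℤ) ∣ (v : ℤ) := Int.natCast_dvd_natCast.mpr hqv
    have d2 : (q : ℤ) ∣ σ₁ * 2 ^ s * p ^ i * u ^ k * (v : ℤ) ^ m * 2 ^ (n * l) :=
      ((dvd_pow hqv' hm.ne').mul_left _).mul_right _
    have d3 : (q : ℤ) ∣ σ₂ * p ^ (l + i) * (v : ℤ) ^ (m + k) := (dvd_pow hqv' (by omega)).mul_left _
    have d1 : (q : ℤ) ∣ σ₀ * u ^ (m + k) * 2 ^ (n * l + n * i) := by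
      have e : σ₀ * u ^ (m + k) * 2 ^ (n * l + n * i) =
          -(σ₁ * 2 ^ s * p ^ i * u ^ k * (v : ℤ) ^ m * 2 ^ (n * l) + σ₂ * p ^ (l + i) * (v : ℤ) ^ (m + k)) := by
        linear_combination E0
      rw [e]; exact (dvd_add d2 d3).neg_right
    rcases hqZ.dvd_or_dvd d1 with d1 | d1
    · rcases hqZ.dvd_or_dvd d1 with d1 | d1
      · have : (q : ℤ) ∣ 1 := by rcases h₀ with h0 | h0 <;> rw [h0] at d1 <;> simpa using d1
        exact hqZ.not_dvd_one this
      · have hqu : q ∣ u.natAbs := Int.natCast_dvd.mp (hqZ.dvd_of_dvd_pow d1)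
        exact hq.one_lt.ne' (Nat.eq_one_of_dvd_coprimes cop hqu hqv)
    · have h2 : (q : ℤ) ∣ 2 := hqZ.dvd_of_dvd_pow d1
      have h2' : q ∣ 2 := by exact_mod_cast h2
      exact hq2 ((Nat.prime_dvd_prime_iff_eq hq Nat.prime_two).mp h2')
  -- so v = 2^e
  obtain ⟨e, hve⟩ : ∃ e : ℕ, v = 2 ^ e := ⟨_, Nat.eq_prime_pow_of_unique_prime_dvd r.den_ne_zero hv2⟩
  have E1 : σ₀ * u ^ (m + k) * 2 ^ (n * l + n * i) + σ₁ * p ^ i * u ^ k * 2 ^ (s + n * l + e * m) +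
      σ₂ * p ^ (l + i) * 2 ^ (e * m + e * k) = 0 := by
    rw [hve] at E0; push_cast at E0
    rw [← pow_mul, ← pow_mul] at E0
    linear_combination E0
  -- (2) e ≥ 1 by parity
  have he : 1 ≤ e := by
    by_contra he0
    have he0 : e = 0 := by omega
    simp only [he0, zero_mul, add_zero, pow_zero, mul_one] at E1
    have t1 : Even (σ₀ * u ^ (m + k) * 2 ^ (n * l + n * i)) :=
      even_iff_two_dvd.mpr ((dvd_pow_self 2 (by positivity)).mul_left _)
    have t2 : Even (σ₁ * p ^ i * u ^ k * 2 ^ (s + n * l)) :=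
      even_iff_two_dvd.mpr ((dvd_pow_self 2 (by positivity)).mul_left _)
    have t3 : Odd (σ₂ * p ^ (l + i)) := hσ₂.mul hp.pow
    have hodd := (t1.add t2).add_odd t3
    rw [E1] at hodd
    have := Int.odd_iff.mp hodd
    omega
  -- (3) u is odd
  have huodd : Odd u := by
    have h2v : 2 ∣ v := by rw [hve]; exact dvd_pow_self 2 (by omega)
    have h2u : ¬ 2 ∣ u.natAbs := fun h2u => by
      have hg := Nat.dvd_gcd h2u h2v
      rw [Nat.Coprime.gcd_eq_one cop] at hg
      omega
    exact Int.natAbs_odd.mp (Nat.odd_iff.mpr (Nat.two_dvd_ne_zero.mp h2u))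
  -- (4) the outer weights tie
  have o1 : Odd (σ₀ * u ^ (m + k)) := hσ₀.mul huodd.pow
  have o2 : Odd (σ₁ * p ^ i * u ^ k) := (hσ₁.mul hp.pow).mul huodd.pow
  have o3 : Odd (σ₂ * p ^ (l + i)) := hσ₂.mul hp.pow
  have tie := two_adic_tie o1 o2 o3 E1
  have hAC : n * l + n * i = e * m + e * k ∧ n * l + n * i ≤ s + n * l + e * m := by
    rcases tie with ⟨hab, hac⟩ | ⟨hac, hab⟩ | ⟨hbc, hba⟩
    · exact (weights_absurd hΔ hΔ3 he hn (by omega) (by omega)).elim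
    · exact ⟨hac, hab⟩
    · exact (weights_absurd hΔ hΔ3 he hn (by omega) (by omega)).elim
  refine ⟨e, hve, he, hAC.1, hAC.2, huodd, ?_⟩
  -- (5) divide by 2^A
  obtain ⟨M, hM⟩ : ∃ M, s + n * l + e * m = (n * l + n * i) + M := ⟨_, (Nat.add_sub_cancel' hAC.2).symm⟩
  have hM' : s + n * l + e * m - (n * l + n * i) = M := by omega
  rw [hM']
  rw [hM, ← hAC.1, pow_add] at E1
  have E2 : (2 : ℤ) ^ (n * l + n * i) * (σ₀ * u ^ (m + k) + σ₁ * 2 ^ M * p ^ i * u ^ k + σ₂ * p ^ (l + i)) = 0 := by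
    rw [← E1]; ring
  exact (mul_eq_zero.mp E2).resolve_left (pow_ne_zero _ two_ne_zero)

/-- **THE 2-ADIC FAR SEGMENT, typed** (a corollary of (M1) kept for the territory map): a rational root over a dyadic
abscissa `p/2^n` (`p` odd, `n ≥ 1`) has denominator EXACTLY `2^e` with `n·(l+i) = e·(m+k)` and `e ≥ 1`. -/
theorem den_eq_two_pow_of_root_triP {σ₀ σ₁ σ₂ : ℤ} (h₀ : σ₀ = 1 ∨ σ₀ = -1) (h₁ : σ₁ = 1 ∨ σ₁ = -1)
    (h₂ : σ₂ = 1 ∨ σ₂ = -1) {s m i k l Δ : ℕ} (hi : 0 < i) (hk : 0 < k) (hΔ : l * m = Δ + i * k) (hΔ3 : 3 ≤ Δ)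
    {p : ℤ} (hp : Odd p) {n : ℕ} (hn : 1 ≤ n) {r : ℚ}
    (h : bev (triP σ₀ (σ₁ * 2 ^ s) σ₂ m i k l) ((p : ℝ) / 2 ^ n) r = 0) :
    ∃ e : ℕ, r.den = 2 ^ e ∧ 1 ≤ e ∧ n * (l + i) = e * (m + k) := by
  obtain ⟨e, hve, he, hw, -⟩ := descent_triP h₀ h₁ h₂ hi hk hΔ hΔ3 hp hn h
  exact ⟨e, hve, he, by rw [mul_add, mul_add]; exact hw⟩

/-- splitting a vanishing sum of three integers by signs. -/
theorem natAbs_cases {x y z : ℤ} (h : x + y + z = 0) :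
    x.natAbs + y.natAbs = z.natAbs ∨ x.natAbs + z.natAbs = y.natAbs ∨ y.natAbs + z.natAbs = x.natAbs := by
  omega

/-- **THE DYADIC THEOREM.**  A trinomial of the class `FermatTri` has NO rational point over any dyadic abscissa
`x = p/2^n` with `p` odd, `|p| ≠ 1`, `n ≥ 1`. -/
theorem bev_triP_ne_zero {σ₀ σ₁ σ₂ : ℤ} (h₀ : σ₀ = 1 ∨ σ₀ = -1) (h₁ : σ₁ = 1 ∨ σ₁ = -1) (h₂ : σ₂ = 1 ∨ σ₂ = -1)
    {s m i k l Δ : ℕ} (hi : 0 < i) (hk : 0 < k) (hΔ : l * m = Δ + i * k) (hΔo : Odd Δ) (hΔ3 : 3 ≤ Δ)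
    (hmi : Nat.Coprime m i) (hkl : Nat.Coprime k l) {p : ℤ} (hp : Odd p) (hp1 : p.natAbs ≠ 1) {n : ℕ}
    (hn : 1 ≤ n) (r : ℚ) : bev (triP σ₀ (σ₁ * 2 ^ s) σ₂ m i k l) ((p : ℝ) / 2 ^ n) r ≠ 0 := by
  intro h
  obtain ⟨e, -, -, -, -, hu, hcore⟩ := descent_triP h₀ h₁ h₂ hi hk hΔ hΔ3 hp hn h
  set M := s + n * l + e * m - (n * l + n * i)
  have hP : Odd p.natAbs := Int.natAbs_odd.mpr hp
  have hU : Odd r.num.natAbs := Int.natAbs_odd.mpr hu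
  have a1 : (σ₀ * r.num ^ (m + k)).natAbs = r.num.natAbs ^ (m + k) := by
    rw [Int.natAbs_mul, Int.natAbs_pow, natAbs_of_sign h₀, one_mul]
  have a2 : (σ₁ * 2 ^ M * p ^ i * r.num ^ k).natAbs = 2 ^ M * p.natAbs ^ i * r.num.natAbs ^ k := by
    rw [Int.natAbs_mul, Int.natAbs_mul, Int.natAbs_mul, Int.natAbs_pow, Int.natAbs_pow, Int.natAbs_pow,
      natAbs_of_sign h₁, one_mul]
    rfl
  have a3 : (σ₂ * p ^ (l + i)).natAbs = p.natAbs ^ (l + i) := by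
    rw [Int.natAbs_mul, Int.natAbs_pow, natAbs_of_sign h₂, one_mul]
  have cases := natAbs_cases hcore
  rw [a1, a2, a3] at cases
  exact hp1 (trinomial_core hi hk hΔ hΔo hΔ3 hmi hkl hP hU cases).1

end TwoAdic

/-! ## §D  THE K-LINE: no level point at any level `N ≥ 2`; the doors -/

section KLine

/-- `3 ≤ p_N` for `N ≥ 2` (`p_2 = 5`): the numerator of `s_N` is never `±1`. -/
theorem three_le_psNumer {N : ℕ} (hN : 2 ≤ N) : 3 ≤ psNumer 2 N := by
  obtain ⟨M, rfl⟩ : ∃ M, N = M + 1 := ⟨N - 1, by omega⟩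
  rw [Summit.Schanuel.Schanuel.Theorems.RootDecomp1KDegreeLadder.psNumer_succ]
  have h1 : 1 ≤ psNumer 2 M := psNumer_pos_runge M
  have hf : 1 ≤ (M + 1)! - M ! := by
    have e1 : (M + 1)! = (M + 1) * M ! := Nat.factorial_succ M
    have e2 : 1 ≤ M ! := Nat.factorial_pos M
    have e3 : 2 * M ! ≤ (M + 1) * M ! := Nat.mul_le_mul_right _ (by omega)
    omega
  have h2 : 2 ≤ 2 ^ ((M + 1)! - M !) := by
    calc 2 = 2 ^ 1 := by norm_num
      _ ≤ 2 ^ ((M + 1)! - M !) := Nat.pow_le_pow_right (by norm_num) hf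
  nlinarith

/-- `s_N = p_N / 2^{N!}` with the numerator cast through `ℤ`. -/
theorem partialSum_two_eq_int_div (N : ℕ) : partialSum 2 N = ((psNumer 2 N : ℤ) : ℝ) / 2 ^ N ! := by
  have e := partialSum_eq_psNumer_div (b := 2) (by norm_num) N
  push_cast at e ⊢
  simpa using e

/-- **NO LEVEL POINT AT ANY LEVEL `N ≥ 2`** for a trinomial of the class (the K-line abscissa `s_N = p_N/2^{N!}` has
`p_N` odd `≥ 5`). -/
theorem no_level_triP {σ₀ σ₁ σ₂ : ℤ} (h₀ : σ₀ = 1 ∨ σ₀ = -1) (h₁ : σ₁ = 1 ∨ σ₁ = -1) (h₂ : σ₂ = 1 ∨ σ₂ = -1)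
    {s m i k l Δ : ℕ} (hi : 0 < i) (hk : 0 < k) (hΔ : l * m = Δ + i * k) (hΔo : Odd Δ) (hΔ3 : 3 ≤ Δ)
    (hmi : Nat.Coprime m i) (hkl : Nat.Coprime k l) {N : ℕ} (hN : 2 ≤ N) (r : ℚ) :
    bev (triP σ₀ (σ₁ * 2 ^ s) σ₂ m i k l) (partialSum 2 N) r ≠ 0 := by
  rw [partialSum_two_eq_int_div]
  have hodd : Odd (psNumer 2 N) := Nat.coprime_two_right.mp (coprime_psNumer 2 hN)
  refine bev_triP_ne_zero h₀ h₁ h₂ hi hk hΔ hΔo hΔ3 hmi hkl (hodd.natCast (R := ℤ)) ?_ (Nat.factorial_pos N) r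
  rw [Int.natAbs_natCast]
  have := three_le_psNumer hN
  omega

variable {P : ℤ[X][X]}

/-- **(E) THE CLASS THEOREM**: a `FermatTri` curve has NO rational point at any level `N ≥ 2` of the K-line. -/
theorem no_level_of_fermatTri (hP : FermatTri P) {N : ℕ} (hN : 2 ≤ N) (r : ℚ) : bev P (partialSum 2 N) r ≠ 0 := by
  obtain ⟨σ₀, σ₁, σ₂, s, m, i, k, l, Δ, h₀, h₁, h₂, hi, hk, hΔ, hΔo, hΔ3, hmi, hkl, rfl⟩ := hP
  exact no_level_triP h₀ h₁ h₂ hi hk hΔ hΔo hΔ3 hmi hkl hN r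

/-- the level sets of a `FermatTri` curve lie in `{0, 1}`. -/
theorem levelSet_subset_of_fermatTri (hP : FermatTri P) (C : ℝ) : LevelSet P C ⊆ {N | N < 2} := by
  intro N hN
  obtain ⟨r, -, hroot, -⟩ := hN
  by_contra hlt
  simp only [Set.mem_setOf_eq, not_lt] at hlt
  exact no_level_of_fermatTri hP hlt r hroot

/-- **DOOR 1: `LevelFinite P`** for every `P ∈ FermatTri` — hypothesis-free. -/
theorem levelFinite_of_fermatTri (hP : FermatTri P) : LevelFinite P := fun C =>
  (Set.finite_lt_nat 2).subset (levelSet_subset_of_fermatTri hP C)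

/-- **DOOR 2: `ThinFibreAt m₀ P` at EVERY quality `m₀`** (in particular the K-line's `m₀ = 2`) — hypothesis-free. -/
theorem thinFibreAt_of_fermatTri (hP : FermatTri P) (m₀ : ℕ) : ThinFibreAt m₀ P :=
  thinFibreAt_of_levelFinite (levelFinite_of_fermatTri hP) m₀

/-- **DOOR 3: `BddLevelEmpty P`** — hypothesis-free. -/
theorem bddLevelEmpty_of_fermatTri (hP : FermatTri P) : BddLevelEmpty P :=
  (bddLevelEmpty_iff_levelFinite P).mpr (levelFinite_of_fermatTri hP)

end KLine

end Summit.Schanuel.Schanuel.Theorems.RootDecomp1KTrinomialDescent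

end
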